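import Summits.BirchSwinnertonDyer.BirchSwinnertonDyer.Theorems.AlignedTransportAtTwoMainConjectureOfRankZeroBSDAtTwoCubicProCyclicDoor
import Literature.NumberTheory.IwasawaTheory.ClassGroupPRankLeOfNotElementaryLayer
import HarnessLib

/-!
# Route `AlignedTransportAtTwo`, crux C2 `MainConjectureOfRankZeroBSDAtTwo` (stmt-BirchSwinnertonDyer-22298):
# THE ELEMENTARY-LAYER DOOR INTO `MC₂(W)` — for the cubic `2`-torsion field `ℚ(β)` with `h(ℚ(β))` odd and `ord₂ h(K_1) ≤ 1` (the HARD CORE included):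
# ONE layer `K_k` with `ord₂ h(K_k) ≠ 2^k − 1` (or ONE ideal class of order `4` in `Cl(K_k)`) forces `rank₂ Cl(K_m) ≤ 2^k − 2` for every `m`, `μ₂ = 0`,
# `λ₂ ≤ 2^k − 2`, and `MC₂(W)` modulo PRINT⁵ + MuIneqʳ

HONEST FRAMING (cell `bsd-f1-sign2`, WIDTH-5 attached prover seat `bsd-line-att-p3` gen 47 on line `birth` of the lead `bsd-line-att-p2`;
`--supports` stmt-BirchSwinnertonDyer-22298, closes nothing; BSD is NOT proved by any of this; the crux C2, its verdict «blocked-on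
`Rank1Residual.GreenbergMuConjectureIrreducible`» and every registered stub are untouched).  THEOREMS ONLY — no definition, no named fact, no `sorry`.
The `W`-level packaging of this seat's Literature door `IwasawaTheory/ClassGroupPRankLeOfNotElementaryLayer` (over a base with `p ∤ h_K`, Fukuda index `0`,
`e_1 ≤ 1`: `e_k ≠ p^k − 1` for ONE `k`, or `r_k < e_k`, ⟹ `r_m ≤ p^k − 2 ∀ m`, `μ = 0`, `λ ≤ p^k − 2`; algebra `IwasawaTheory/FukudaElementaryLayer{Nakayama,Generator,Algebra}`),
companion of att-p3 g42–g46's `…CubicDepthDoor{,GenusCert}`, `…CubicLayerTwo{UnitDoorFlex,RowN9139}`, `…CubicCapitulationDoor`, `…CubicProCyclicDoor`.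

WHY.  In `Λ`-terms (`X = Λ/J` for `h(ℚ(β))` odd; `e_1 ≤ 1` makes `X` cyclic over `Λ` with `2 ∈ J + T²Λ` unless `X` is pro-cyclic): `μ₂ > 0` would force `J = 2Λ`
and `Cl(K_k)[2^∞] ≅ (ℤ/2)^{2^k−1}` — ELEMENTARY abelian of maximal rank — at EVERY layer; so ONE layer whose `2`-class group is not of that exact shape (order
`≠ 2^{2^k−1}`, or containing a class of order `4`) kills `μ₂`, and the Weierstrass degree bound gives `λ₂ ≤ 2^k − 2`.  This is the FIRST lever on the cell's
HARD CORE `t = 3 ∧ e_1 = 1` (seeds `1259, 3027, 3523, 14891`, dead at layer `2` for every unit / rank door) whose per-seed datum is ONE class number of a layer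
(`ord₂ h(K_2) ≠ 3`, degree `12`) or ONE ideal class of order `4` — a LOWER-BOUND-type certificate — instead of a degree-`24` unit or a full `2`-rank.

* ★★ **`classicalMuVanishes_adjoin_of_classNumberPExp_ne`** — `W` globally minimal, good ordinary at `2`, no rational `2`-torsion abscissa, `β` a root of the
  `2`-division cubic; displayed: `h(ℚ(β))` odd, `2 ∤ d_{ℚ(β)}`; `κ` a cyclotomic `ℤ₂`-extension of `ℚ(β)` with `ord₂ h(K_1) ≤ 1` and **`ord₂ h(K_k) ≠ 2^k − 1`** ⟹
  `rank₂ Cl(K_m) ≤ 2^k − 2 ∀ m`, `μ₂(κ) = 0`, `λ₂(κ) ≤ 2^k − 2`;  **`…_of_orderOf_eq_four`** — the same from ONE class of order `4` in `Cl(K_k)`.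
* ★ **`mazurMainConjecture_two_of_muIneqRel_of_classNumberPExp_ne`** — PRINT⁵ + MuIneqʳ (registered stub verbatim) + the cell hypotheses + `Δ_W < 0` + the displayed
  data (for every cyclotomic `κ`: `ord₂ h(K_1) ≤ 1` and SOME layer with `ord₂ h(K_k) ≠ 2^k − 1`) ⟹ `MC₂(W)` (att-p5 g24's cubic carrier road).

CONDITIONAL theorems (PRINT⁵, MuIneqʳ, and the displayed class-number data); nothing is asserted about any curve; nothing is closed; BSD is not proved.

References: [Washington1997] §13.3 Prop. 13.22–13.23; [Fukuda1994] Thm. 1 and proof, p. 264; [Lang1990] Ch. 5 §1–§2, Ch. 13 §4; [Kato2004Asterisque] Thm. 17.4 (1)(2)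
(p. 273); [GreenbergLNM1716] Thm. 4.1 (p. 102), Conj. 1.11 (p. 58); tree: this seat's `ClassGroupPRankLeOfNotElementaryLayer`, att-p5 g24 `…CubicCarrierRoad`,
att-p3 g46 `…CubicProCyclicDoor` (template).
-/

set_option linter.dupNamespace false
set_option autoImplicit false

noncomputable section

open scoped Classical NumberField nonZeroDivisors

namespace Summit.BirchSwinnertonDyer.BirchSwinnertonDyer.Theorems.AlignedTransportAtTwoCubicElementaryLayerDoor

open NumberField IsDedekindDomain Polynomial WeierstrassCurve IntermediateField CongruenceSubgroup
  Literature.NumberTheory.IwasawaTheory Literature.NumberTheory.GaloisRepresentations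
  Literature.NumberTheory.EllipticCurves Literature.NumberTheory.EllipticCurves.Greenberg1999
  Literature.NumberTheory.EllipticCurves.ModularForms
  Literature.NumberTheory.EllipticCurves.Rank1Residual
  Literature.NumberTheory.EllipticCurves.Module
  Literature.NumberTheory.NumberFields
  Summit.BirchSwinnertonDyer.Rank1Residual
  Summit.BirchSwinnertonDyer.Rank1Residual.X1.MuLambda
  Summit.BirchSwinnertonDyer.Rank1Residual.X5
  Summit.BirchSwinnertonDyer.Rank1Residual.F1Sign2
  Summit.BirchSwinnertonDyer.BirchSwinnertonDyer.Theorems.Rank1ResidualX1Defs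
  Summit.BirchSwinnertonDyer.BirchSwinnertonDyer.Theses.AlignedTransportAtTwo
  Summit.BirchSwinnertonDyer.BirchSwinnertonDyer.Theorems.AlignedTransportAtTwoKilfordStratumShared
  Summit.BirchSwinnertonDyer.BirchSwinnertonDyer.Theorems.AlignedTransportAtTwoCubicCarrierRoad

variable (W : WeierstrassCurve ℚ) [W.IsElliptic] [W.IsGloballyMinimal]

/-! ## §1 `μ₂ = 0`, `λ₂ ≤ 2^k − 2` for the cubic `2`-torsion field from ONE layer with `ord₂ h(K_k) ≠ 2^k − 1` -/

omit [W.IsGloballyMinimal] in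
/-- ★★ **THE ELEMENTARY-LAYER DOOR FOR THE CUBIC `2`-TORSION FIELD.**  `W/ℚ` globally minimal, no rational `2`-torsion abscissa, `β ∈ ℚ̄` a root of the
`2`-division cubic; displayed: `h(ℚ(β))` odd and `2 ∤ d_{ℚ(β)}` (so Fukuda's index is `0` for every cyclotomic `ℤ₂`-extension); `κ` a cyclotomic
`ℤ₂`-extension of `ℚ(β)` with **`ord₂ h(K_1) ≤ 1`** and **`ord₂ h(K_k) ≠ 2^k − 1`** for one `k`.  THEN `rank₂ Cl(K_m) ≤ 2^k − 2` for every `m`, `μ₂(κ) = 0` and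
`λ₂(κ) ≤ 2^k − 2`.  (`k = 2` on the hard core: «`ord₂ h(K_2) ≠ 3`».) [cite: Washington1997, §13.3 Prop. 13.22–13.23] [cite: Fukuda1994, Thm. 1 and proof, p. 264]
[cite: Lang1990, Ch. 5 §2 (Weierstrass preparation)] -/
theorem classicalMuVanishes_adjoin_of_classNumberPExp_ne (ht : ∀ x : ℚ, ¬ HasRationalTwoTorsionX W x)
    {β : AlgebraicClosure ℚ} (hβ : aeval β W.twoTorsionPolynomial.toPoly = 0)
    (hh : haveI : FiniteDimensional ℚ ↥(IntermediateField.adjoin ℚ ({β} : Set (AlgebraicClosure ℚ))) :=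
        IntermediateField.adjoin.finiteDimensional ((AlgebraicClosure.isAlgebraic ℚ).isAlgebraic β).isIntegral
      haveI : NumberField ↥(IntermediateField.adjoin ℚ ({β} : Set (AlgebraicClosure ℚ))) := NumberField.mk
      ¬ 2 ∣ classNumber ↥(IntermediateField.adjoin ℚ ({β} : Set (AlgebraicClosure ℚ))))
    (hd : haveI : FiniteDimensional ℚ ↥(IntermediateField.adjoin ℚ ({β} : Set (AlgebraicClosure ℚ))) :=
        IntermediateField.adjoin.finiteDimensional ((AlgebraicClosure.isAlgebraic ℚ).isAlgebraic β).isIntegral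
      haveI : NumberField ↥(IntermediateField.adjoin ℚ ({β} : Set (AlgebraicClosure ℚ))) := NumberField.mk
      ¬ (2 : ℤ) ∣ NumberField.discr ↥(IntermediateField.adjoin ℚ ({β} : Set (AlgebraicClosure ℚ))))
    (κP : ZpExtension ↥(IntermediateField.adjoin ℚ ({β} : Set (AlgebraicClosure ℚ))) 2) (hκP : κP.IsCyclotomic)
    (h1 : classNumberPExp κP 1 ≤ 1) {k : ℕ} (hk : classNumberPExp κP k ≠ 2 ^ k - 1) :
    (∀ m, classGroupPRank κP m ≤ 2 ^ k - 2) ∧ ClassicalMuVanishes κP ∧ classicalLambda κP ≤ 2 ^ k - 2 := by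
  have hirr := AlignedTransportAtTwoSeed.irr_two_of_forall_not_hasRationalTwoTorsionX W ht
  have hβint : IsIntegral ℚ β := ((AlgebraicClosure.isAlgebraic ℚ).isAlgebraic β).isIntegral
  haveI : FiniteDimensional ℚ ↥(IntermediateField.adjoin ℚ ({β} : Set (AlgebraicClosure ℚ))) := IntermediateField.adjoin.finiteDimensional hβint
  haveI : NumberField ↥(IntermediateField.adjoin ℚ ({β} : Set (AlgebraicClosure ℚ))) := NumberField.mk
  have h3 : Module.finrank ℚ ↥(IntermediateField.adjoin ℚ ({β} : Set (AlgebraicClosure ℚ))) = 3 :=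
    AddKatoTwo.finrank_adjoin_root_twoTorsionPolynomial_eq_three W hirr hβ
  have hodd3 : ¬ 2 ∣ Module.finrank ℚ ↥(IntermediateField.adjoin ℚ ({β} : Set (AlgebraicClosure ℚ))) := by rw [h3]; decide
  exact classicalMuVanishes_two_of_classNumberPExp_ne_of_not_dvd_discr hodd3 hd hh κP hκP h1 hk

omit [W.IsGloballyMinimal] in
/-- ★★ **The same door from ONE ideal class of order `4`**: `W`, `β`, `h(ℚ(β))` odd, `2 ∤ d_{ℚ(β)}`, `κ` cyclotomic with `ord₂ h(K_1) ≤ 1`, and a class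
`c ∈ Cl(K_k)` of order exactly `4` ⟹ `rank₂ Cl(K_m) ≤ 2^k − 2 ∀ m`, `μ₂(κ) = 0`, `λ₂(κ) ≤ 2^k − 2`. [cite: Washington1997, §13.3 Prop. 13.22–13.23]
[cite: Fukuda1994, Thm. 1 and proof, p. 264] -/
theorem classicalMuVanishes_adjoin_of_orderOf_eq_four (ht : ∀ x : ℚ, ¬ HasRationalTwoTorsionX W x)
    {β : AlgebraicClosure ℚ} (hβ : aeval β W.twoTorsionPolynomial.toPoly = 0)
    (hh : haveI : FiniteDimensional ℚ ↥(IntermediateField.adjoin ℚ ({β} : Set (AlgebraicClosure ℚ))) :=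
        IntermediateField.adjoin.finiteDimensional ((AlgebraicClosure.isAlgebraic ℚ).isAlgebraic β).isIntegral
      haveI : NumberField ↥(IntermediateField.adjoin ℚ ({β} : Set (AlgebraicClosure ℚ))) := NumberField.mk
      ¬ 2 ∣ classNumber ↥(IntermediateField.adjoin ℚ ({β} : Set (AlgebraicClosure ℚ))))
    (hd : haveI : FiniteDimensional ℚ ↥(IntermediateField.adjoin ℚ ({β} : Set (AlgebraicClosure ℚ))) :=
        IntermediateField.adjoin.finiteDimensional ((AlgebraicClosure.isAlgebraic ℚ).isAlgebraic β).isIntegral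
      haveI : NumberField ↥(IntermediateField.adjoin ℚ ({β} : Set (AlgebraicClosure ℚ))) := NumberField.mk
      ¬ (2 : ℤ) ∣ NumberField.discr ↥(IntermediateField.adjoin ℚ ({β} : Set (AlgebraicClosure ℚ))))
    (κP : ZpExtension ↥(IntermediateField.adjoin ℚ ({β} : Set (AlgebraicClosure ℚ))) 2) (hκP : κP.IsCyclotomic)
    (h1 : classNumberPExp κP 1 ≤ 1) {k : ℕ} {c : ClassGroup (𝓞 (κP.layer k))} (hc : orderOf c = 4) :
    (∀ m, classGroupPRank κP m ≤ 2 ^ k - 2) ∧ ClassicalMuVanishes κP ∧ classicalLambda κP ≤ 2 ^ k - 2 := by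
  have hirr := AlignedTransportAtTwoSeed.irr_two_of_forall_not_hasRationalTwoTorsionX W ht
  have hβint : IsIntegral ℚ β := ((AlgebraicClosure.isAlgebraic ℚ).isAlgebraic β).isIntegral
  haveI : FiniteDimensional ℚ ↥(IntermediateField.adjoin ℚ ({β} : Set (AlgebraicClosure ℚ))) := IntermediateField.adjoin.finiteDimensional hβint
  haveI : NumberField ↥(IntermediateField.adjoin ℚ ({β} : Set (AlgebraicClosure ℚ))) := NumberField.mk
  have h3 : Module.finrank ℚ ↥(IntermediateField.adjoin ℚ ({β} : Set (AlgebraicClosure ℚ))) = 3 :=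
    AddKatoTwo.finrank_adjoin_root_twoTorsionPolynomial_eq_three W hirr hβ
  have hodd3 : ¬ 2 ∣ Module.finrank ℚ ↥(IntermediateField.adjoin ℚ ({β} : Set (AlgebraicClosure ℚ))) := by rw [h3]; decide
  exact classicalMuVanishes_two_of_orderOf_eq_four_of_not_dvd_discr hodd3 hd hh κP hκP h1 hc

/-! ## §2 The door into `MC₂(W)` -/

/-- ★ **THE ELEMENTARY-LAYER DOOR INTO `MC₂(W)`.**  PRINT⁵ {Kato 17.4 (1)(2) at `2` (`h17`), Greenberg 4.1 (`hGr`), period unit (`hper`), modularity (`hmod`),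
GZK (`hGZK`)} + MuIneqʳ (`hI`, the registered stub VERBATIM) + the cell hypotheses (good ordinary at `2`, no rational `2`-torsion abscissa, `Δ_W < 0`, `r_an = 0`, analytic
`μ₂ = 0` on the even branch, `BSD₂(W)`) + `β` a root of the `2`-division cubic + the displayed data of `ℚ(β)` (`h` odd, `2 ∤ d`, and for every cyclotomic
`ℤ₂`-extension: `ord₂ h(K_1) ≤ 1` and SOME layer `k` with `ord₂ h(K_k) ≠ 2^k − 1`) ⟹ `MC₂(W)` (att-p5 g24's cubic carrier road ∘ §1).
[cite: Kato2004Asterisque, Thm. 17.4 (1)(2) (p. 273)] [cite: GreenbergLNM1716, Thm. 4.1 (p. 102) and Conj. 1.11 (p. 58)]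
[cite: Iwasawa1973MuInvariants, Thm. 2 and Thm. 3] [cite: Washington1997, §13.3 Prop. 13.22–13.23] [cite: Fukuda1994, Thm. 1, p. 264] -/
theorem mazurMainConjecture_two_of_muIneqRel_of_classNumberPExp_ne
    (h17 : ∀ [NeZero (W.conductorNorm ℤ)] (f : CuspForm (Gamma0 (W.conductorNorm ℤ)) 2),
      kato_divisibility_allPrimes W 2 (f := f))
    (hGr : Greenberg1999.thm41_charValue_rankZero_anyPrime)
    (hper : realPeriodRat_eq_unit_mul_plusPeriod_two) (hmod : nonempty_modularParametrizationData)
    (hGZK : rank_eq_analyticRank_of_analyticRank_le_one)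
    (hI : ∀ (W : WeierstrassCurve ℚ) [W.IsElliptic] [W.IsGloballyMinimal], IsOrdinaryAt W 2 →
      (∀ x : ℚ, ¬ HasRationalTwoTorsionX W x) →
      ∀ (κ : ZpExtension ℚ 2) (γ : Field.absoluteGaloisGroup ℚ), κ.IsCyclotomic →
      κ.IsTopGenerator γ → IsCyclotomicVariable 2 γ →
      ∀ ⦃N : ℕ⦄ [NeZero N] (f : CuspForm (Gamma0 N) 2), IsNewformOf W f →
      ∀ Gp : IwasawaAlgebra 2, iwasawaToPowerSeries 2 Gp = padicLFunction f (unitRoot W 2 : ℚ_[2]) →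
      ∀ (D : W.SelmerDualData κ γ) (Yr : W.FineSelmerDualDataRelaxedInf κ γ),
        lengthAt (IwasawaAlgebra 2) D.X ⟨IwasawaAlgebra.augIdealP 2, IwasawaAlgebra.isPrime_augIdealP_holds 2⟩ ≤
          lengthAt (IwasawaAlgebra 2) (IwasawaAlgebra 2 ⧸ Ideal.span {Gp})
              ⟨IwasawaAlgebra.augIdealP 2, IwasawaAlgebra.isPrime_augIdealP_holds 2⟩ +
            lengthAt (IwasawaAlgebra 2) Yr.X ⟨IwasawaAlgebra.augIdealP 2, IwasawaAlgebra.isPrime_augIdealP_holds 2⟩)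
    (hord : IsOrdinaryAt W 2) (ht : ∀ x : ℚ, ¬ HasRationalTwoTorsionX W x) (hΔ : W.Δ < 0) (hr : W.analyticRank = 0)
    (hμan : ∀ ⦃N : ℕ⦄ [NeZero N] (f : CuspForm (Gamma0 N) 2), IsNewformOf W f →
      ∀ G : IwasawaAlgebra 2, IsEvenBranchLiftAtTwo W f G → red G ≠ 0)
    (hbsd : BSDp W 2)
    {β : AlgebraicClosure ℚ} (hβ : aeval β W.twoTorsionPolynomial.toPoly = 0)
    (hh : haveI : FiniteDimensional ℚ ↥(IntermediateField.adjoin ℚ ({β} : Set (AlgebraicClosure ℚ))) :=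
        IntermediateField.adjoin.finiteDimensional ((AlgebraicClosure.isAlgebraic ℚ).isAlgebraic β).isIntegral
      haveI : NumberField ↥(IntermediateField.adjoin ℚ ({β} : Set (AlgebraicClosure ℚ))) := NumberField.mk
      ¬ 2 ∣ classNumber ↥(IntermediateField.adjoin ℚ ({β} : Set (AlgebraicClosure ℚ))))
    (hd : haveI : FiniteDimensional ℚ ↥(IntermediateField.adjoin ℚ ({β} : Set (AlgebraicClosure ℚ))) :=
        IntermediateField.adjoin.finiteDimensional ((AlgebraicClosure.isAlgebraic ℚ).isAlgebraic β).isIntegral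
      haveI : NumberField ↥(IntermediateField.adjoin ℚ ({β} : Set (AlgebraicClosure ℚ))) := NumberField.mk
      ¬ (2 : ℤ) ∣ NumberField.discr ↥(IntermediateField.adjoin ℚ ({β} : Set (AlgebraicClosure ℚ))))
    (hdata : ∀ κP : ZpExtension ↥(IntermediateField.adjoin ℚ ({β} : Set (AlgebraicClosure ℚ))) 2, κP.IsCyclotomic →
      classNumberPExp κP 1 ≤ 1 ∧ ∃ k : ℕ, classNumberPExp κP k ≠ 2 ^ k - 1) :
    MazurMainConjecture W 2 :=
  mazurMainConjecture_two_of_muIneqRel_of_classicalMu_cubicField_of_Δ_neg W h17 hGr hper hmod hGZK hI hord ht hΔ hr hμan hbsd hβ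
    fun κP hκP => by
      obtain ⟨h1, k, hk⟩ := hdata κP hκP
      exact (classicalMuVanishes_adjoin_of_classNumberPExp_ne W ht hβ hh hd κP hκP h1 hk).2.1

end Summit.BirchSwinnertonDyer.BirchSwinnertonDyer.Theorems.AlignedTransportAtTwoCubicElementaryLayerDoor

end
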